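import Mathlib

/-!
# Route OverlapGapAlgebra, crux `SearchHardWindow` (stmt-PneNP-2460): blocks of `L` literals —
# the padding equivalence and the block walk data

Bookkeeping for the block form of `scanCorrelation_paths` (`…BlockPaths.lean`). Group the `m·k` literal slots of an
instance `Fin m → Fin k → Fin n × Bool` into consecutive BLOCKS of `L` slots in the lexicographic
(Bresler–Huang) order, padding the last block: a padded instance is a
`Φ̂ : Fin m' → Fin k → (Fin L → Fin n × Bool)` with `m ≤ m'·L`, read back as the instance
`proj Φ̂ (a, c) = Φ̂ a' c' o` where `a'·k + c' = (a·k + c)/L`, `o = (a·k + c) mod L` (the padding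
equivalence `blk_padEquiv : padded ≃ instances × junk`, uniform fibres). On padded instances the
interpolation path with checkpoints is LITERALLY the single-symbol splice path over the block alphabet
`Fin L → Fin n × Bool` (`blk_pathIsWalk`, `…BlockWalk.lean`), so the abstract correlation inequality
`scc_count` + `scc_defect_le` (`…ScanCorrelation.lean`) apply with `T' = k·(m'·k)` block steps.

This file: the index arithmetic, the padding equivalence `blk_padEquiv` (with the explicit block /
offset indices of every slot), and the walk data `blk_walkData` (direction schedule and a realisation
of the resampling walk). No definitions (the objects are delivered existentially).

References: G. Bresler, B. Huang, arXiv:2106.02129, Def. 4.2 [BreslerHuang2022]; B. Huang,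
M. Sellke, arXiv:2501.06427, Lemma 3.1 [HuangSellke2025] (correlation for reversible ensembles).
-/

namespace Summit.PneNP.PneNP.Theorems

set_option linter.dupNamespace false -- `Summit.PneNP.PneNP.…`: summit = sub-problem (D-0017)

open Finset
open scoped Classical

/-! ### Index arithmetic -/

/-- `r < R` and `s < M` give `r·M + s < R·M`. -/
theorem blk_lin_lt {R M r s : ℕ} (hr : r < R) (hs : s < M) : r * M + s < R * M :=
  calc r * M + s < r * M + M := by omega
    _ = (r + 1) * M := by ring
    _ ≤ R * M := Nat.mul_le_mul_right M hr

/-! ### The padding equivalence -/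

/-- **The padding equivalence.** For `m ≤ m'·L`, padded instances
`Fin m' → Fin k → (Fin L → S)` (blocks of `L` symbols, `m'·k` blocks) are in bijection with pairs
(instance `Fin m → Fin k → S`, junk word of length `m'kL − mk`), the instance component reading slot
`(a, c)` from block `(a·k + c)/L` at offset `(a·k + c) mod L`. -/
theorem blk_padEquiv (S : Type*) (k m L m' : ℕ) (hL : 1 ≤ L) (hmm' : m ≤ m' * L) :
    ∃ e : (Fin m' → Fin k → Fin L → S) ≃ (Fin m → Fin k → S) × (Fin (m' * k * L - m * k) → S),
      ∀ (a : Fin m) (c : Fin k), ∃ (a' : Fin m') (c' : Fin k) (o : Fin L),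
        (a' : ℕ) * k + c' = ((a : ℕ) * k + c) / L ∧ (o : ℕ) = ((a : ℕ) * k + c) % L ∧
        ∀ Φ : Fin m' → Fin k → Fin L → S, (e Φ).1 a c = Φ a' c' o := by
  have blk_div_eq : ∀ {M r s : ℕ}, s < M → (r * M + s) / M = r := fun {M r s} hs => by
    rw [Nat.add_comm, Nat.add_mul_div_right _ _ (by omega), Nat.div_eq_of_lt hs, Nat.zero_add]
  have blk_mod_eq : ∀ {M r s : ℕ}, s < M → (r * M + s) % M = s := fun hs =>
    Nat.mul_add_mod_of_lt hs
  have hL0 : 0 < L := hL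
  have hW : m * k ≤ m' * k * L := by
    calc m * k ≤ m' * L * k := Nat.mul_le_mul_right k hmm'
      _ = m' * k * L := by ring
  -- index bounds
  have hblk : ∀ {p : ℕ}, p < m' * k * L → p / L < m' * k := fun hp =>
    (Nat.div_lt_iff_lt_mul hL0).2 hp
  have hk_of : ∀ {p : ℕ}, p < m' * k * L → 0 < k := fun {p} hp => by
    rcases Nat.eq_zero_or_pos k with h | h
    · rw [h, Nat.mul_zero, Nat.zero_mul] at hp; omega
    · exact h
  have ha' : ∀ {p : ℕ}, p < m' * k * L → p / L / k < m' := fun hp =>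
    (Nat.div_lt_iff_lt_mul (hk_of hp)).2 (hblk hp)
  have hc' : ∀ {p : ℕ}, p < m' * k * L → p / L % k < k := fun hp => Nat.mod_lt _ (hk_of hp)
  have ho : ∀ {p : ℕ}, p < m' * k * L → p % L < L := fun _ => Nat.mod_lt _ hL0
  have hunflat : ∀ (a' : Fin m') (c' : Fin k) (o : Fin L),
      ((a' : ℕ) * k + c') * L + o < m' * k * L := fun a' c' o =>
    blk_lin_lt (blk_lin_lt a'.isLt c'.isLt) o.isLt
  -- (1) flattening `Fin m' → Fin k → Fin L → S ≃ Fin (m' k L) → S`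
  let e₁ : (Fin m' → Fin k → Fin L → S) ≃ (Fin (m' * k * L) → S) :=
    { toFun := fun Φ p => Φ ⟨(p : ℕ) / L / k, ha' p.isLt⟩ ⟨(p : ℕ) / L % k, hc' p.isLt⟩
        ⟨(p : ℕ) % L, ho p.isLt⟩
      invFun := fun f a' c' o => f ⟨((a' : ℕ) * k + c') * L + o, hunflat a' c' o⟩
      left_inv := fun Φ => by
        funext a' c' o
        dsimp only
        have h1 : (((a' : ℕ) * k + c') * L + o) / L = (a' : ℕ) * k + c' := blk_div_eq o.isLt
        have h2 : (((a' : ℕ) * k + c') * L + o) % L = o := blk_mod_eq o.isLt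
        simp only [h1, h2, blk_div_eq c'.isLt, blk_mod_eq c'.isLt, Fin.eta]
      right_inv := fun f => by
        funext p
        dsimp only
        congr 1
        refine Fin.ext ?_
        show ((p : ℕ) / L / k * k + (p : ℕ) / L % k) * L + (p : ℕ) % L = p
        rw [Nat.div_add_mod' ((p : ℕ) / L) k, Nat.div_add_mod' (p : ℕ) L] }
  -- (2) splitting off the junk `Fin (m' k L) → S ≃ (Fin (m k) → S) × (Fin (m' k L - m k) → S)`
  let e₂ : (Fin (m' * k * L) → S) ≃ (Fin (m * k) → S) × (Fin (m' * k * L - m * k) → S) :=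
    { toFun := fun f => (fun q => f ⟨q, lt_of_lt_of_le q.isLt hW⟩,
        fun j => f ⟨m * k + j, by omega⟩)
      invFun := fun gh p => if hp : (p : ℕ) < m * k then gh.1 ⟨p, hp⟩
        else gh.2 ⟨(p : ℕ) - m * k, by omega⟩
      left_inv := fun f => by
        funext p
        dsimp only
        split_ifs with hp
        · rfl
        · congr 1
          exact Fin.ext (by simp only; omega)
      right_inv := fun gh => by
        ext q
        · dsimp only
          rw [dif_pos q.isLt]
        · dsimp only
          rw [dif_neg (by omega)]
          simp only [Nat.add_sub_cancel_left, Fin.eta] }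
  -- (3) un-flattening the instance `Fin (m k) → S ≃ Fin m → Fin k → S`
  have hq1 : ∀ {q : ℕ}, q < m * k → q / k < m := fun {q} hq => by
    have hk : 0 < k := by
      rcases Nat.eq_zero_or_pos k with h | h
      · rw [h, Nat.mul_zero] at hq; omega
      · exact h
    exact (Nat.div_lt_iff_lt_mul hk).2 hq
  have hq2 : ∀ {q : ℕ}, q < m * k → q % k < k := fun {q} hq => by
    rcases Nat.eq_zero_or_pos k with h | h
    · rw [h, Nat.mul_zero] at hq; omega
    · exact Nat.mod_lt _ h
  let e₃ : (Fin (m * k) → S) ≃ (Fin m → Fin k → S) :=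
    { toFun := fun g a c => g ⟨(a : ℕ) * k + c, blk_lin_lt a.isLt c.isLt⟩
      invFun := fun Φ q => Φ ⟨(q : ℕ) / k, hq1 q.isLt⟩ ⟨(q : ℕ) % k, hq2 q.isLt⟩
      left_inv := fun g => by
        funext q
        dsimp only
        congr 1
        exact Fin.ext (Nat.div_add_mod' (q : ℕ) k)
      right_inv := fun Φ => by
        funext a c
        dsimp only
        congr 1
        · exact Fin.ext (blk_div_eq c.isLt)
        · exact Fin.ext (blk_mod_eq c.isLt) }
  refine ⟨e₁.trans (e₂.trans (Equiv.prodCongr e₃ (Equiv.refl _))), fun a c => ?_⟩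
  have hp : (a : ℕ) * k + c < m' * k * L := lt_of_lt_of_le (blk_lin_lt a.isLt c.isLt) hW
  exact ⟨⟨((a : ℕ) * k + c) / L / k, ha' hp⟩, ⟨((a : ℕ) * k + c) / L % k, hc' hp⟩,
    ⟨((a : ℕ) * k + c) % L, ho hp⟩, Nat.div_add_mod' _ k, rfl, fun Φ => rfl⟩


/-! ### The block walk data -/

/-- The direction schedule `σ t = block (t mod m'k)` (as a pair `((t mod m'k)/k, (t mod m'k) mod k)`)
and a realisation `pos` of the coordinate-resampling walk on `Fin m' × Fin k → S` with `k` sweeps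
(start `v`, step `t` overwrites coordinate `σ t` with the fresh symbol `U t`). -/
theorem blk_walkData (S : Type*) (k m' : ℕ) :
    ∃ (σ : Fin (k * (m' * k)) → Fin m' × Fin k)
      (pos : (Fin m' × Fin k → S) → (Fin (k * (m' * k)) → S) → ℕ → (Fin m' × Fin k → S)),
      (∀ t, ((σ t).1 : ℕ) = (t : ℕ) % (m' * k) / k ∧ ((σ t).2 : ℕ) = (t : ℕ) % (m' * k) % k) ∧
      (∀ v U, pos v U 0 = v) ∧
      ∀ v U (t : Fin (k * (m' * k))), pos v U ((t : ℕ) + 1) = Function.update (pos v U t) (σ t) (U t) := by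
  set T : ℕ := k * (m' * k) with hT
  obtain ⟨σ, hσ⟩ : ∃ σ : Fin T → Fin m' × Fin k,
      ∀ t, ((σ t).1 : ℕ) = (t : ℕ) % (m' * k) / k ∧ ((σ t).2 : ℕ) = (t : ℕ) % (m' * k) % k := by
    have hk : 0 < k ∨ T = 0 := by
      rcases Nat.eq_zero_or_pos k with h | h
      · right; rw [hT, h, zero_mul]
      · left; exact h
    have hmk : 0 < m' * k ∨ T = 0 := by
      rcases Nat.eq_zero_or_pos (m' * k) with h | h
      · right; rw [hT, h, mul_zero]
      · left; exact h
    refine ⟨fun t => (⟨(t : ℕ) % (m' * k) / k, ?_⟩, ⟨(t : ℕ) % (m' * k) % k, ?_⟩), fun t => ⟨rfl, rfl⟩⟩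
    · rcases hmk with hmk | hT0
      · rcases hk with hk | hT0
        · exact (Nat.div_lt_iff_lt_mul hk).2 (Nat.mod_lt _ hmk)
        · exact absurd t.isLt (by omega)
      · exact absurd t.isLt (by omega)
    · rcases hk with hk | hT0
      · exact Nat.mod_lt _ hk
      · exact absurd t.isLt (by omega)
  exact ⟨σ, fun v U t => Nat.rec (motive := fun _ => Fin m' × Fin k → S) v
      (fun t w => if h : t < T then Function.update w (σ ⟨t, h⟩) (U ⟨t, h⟩) else w) t,
    hσ, fun _ _ => rfl, fun v U t => by simp [t.isLt]⟩

end Summit.PneNP.PneNP.Theorems
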